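import Mathlib
import Summits.Ventures.HodgeRepro.OcticCMPointGaloisRingConjDual

/-!
# OcticCMPointGaloisRingE3 — the conductor-`2` root number at `𝔮 | 2` of every conjugate-dual character is `ω(ϖ)^n`;
(E3) across ALL wild classes; every character of `GR(4, 4)^×` is an `ω_{θ,β}`

Blind re-derivation cell `pub-hodge-repro`, seat night-2 (gen 5).  Target tree path
`lean/Summits/Ventures/HodgeRepro/OcticCMPointGaloisRingE3.lean`.  Closes the two items left open by
`OcticCMPointGaloisRingConjDual.lean` (gen 4): (E3) at `𝔮 | 2`, conductor `2`, ACROSS the wild classes, and the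
completeness of the family `ω_{θ,β}`.

**The root number is exactly `ω(ϖ)^n`** (`eps_omega_conjDual_exact`, `eps_conjDual_exact`, `eps_eq_piVal_pow_two`).
For `ω = ⟨ω_{θ,β}, π⟩` conjugate-dual (`θ⁵ = 1` and `σ(β) ≡ β` mod `2GR`, `omega_conjDual_iff`) of conductor exactly `2`
(`β ∉ 2GR`), `OcticCMPointGaloisRingChars.eps_omega` gives `ε(½, ω, ψ̃_δ) = π^n θ^{−k₀} ψ̃_δ(r^{k₀})` with `r^{k₀} ≡ β`.
Conjugate duality forces `4k₀ ≡ k₀` mod `15` (`four_mul_eq_self_of_conjDual`: `σ(r^{k₀}) = r^{4k₀}` has the residue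
of `σ(β)`, i.e. of `β`, i.e. of `r^{k₀}`), so `5 ∣ k₀` and `r^{k₀}` is `σ`-fixed (the Teichmüller lift of `𝔽₄^×`).  Then
`θ^{−k₀} = 1` (`θ⁵ = 1`) and **`tr(δ t) = 0` for every `σ`-fixed `t`** (`tr_delta_mul_eq_zero_of_conjGR_fixed`: the
Frobenius sum of `δ t` is `δt + φ(δt) + σ(δt) + φ(σ(δt))` and `σ(δt) = −δt`), so `ψ̃_δ(r^{k₀}) = 1` and
`ε(½, ω, ψ̃_δ) = π^n` — the unit part of a conjugate-dual character contributes NOTHING to its root number at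
conductor `2`, exactly as at conductor `1` (`OcticCMPointInertGauss.eps_eq_piVal_pow`).  Numerically: all `15`
conjugate-dual characters of conductor exactly `2` (`θ ∈ μ₅`, `β̄ ∈ 𝔽₄^×`) have `ε / π^n = 1`
(`proofs/night-2/g5/numerics/gr44_conjdual_eps.py`).

**(E3) across the wild classes** (`E3_conjDual_inert_two`): for four conjugate-dual lines of conductor exactly `2` —
in ANY wild classes, with NO hypothesis on the unit parts beyond conjugate duality — `ε₀ε₁ = ε₂ε₃` is exactly the
`ϖ`-part `π₀π₁ = π₂π₃` of N2.  The two classes of the route on the nose: `ε = (−1)^n` for `π = −1`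
(`eps_conjSymplectic_inert_two`), `ε = 1` for `π = 1` (`eps_conjOrthogonal_inert_two`).  The stability form
(`E3_tame_twist_inert_two`): four tame lines twisted by ONE conductor-`2` `ρ` satisfy (E3) under N2 on the parameters
(`omega_mul`: `ω_{θ,β} ω_{θ′,β′} = ω_{θθ′,β+β′}`, the transport of N2).

**Completeness** (`exists_omega_eq`): every `χ : MulChar GR44 ℂ` is an `ω_{θ,β}` — `θ = χ(r)` (a `15`-th root of
unity), and the wild part `a ↦ χ(1 + 2a)` is an additive character of `GR(4, 4)` trivial on `2GR`, hence
`ψ̃_δ(γ ·)` with `2γ = 0` (`AddChar.card_eq` + the primitivity of `ψ̃_δ`), i.e. `ψ̃_δ(2β ·)`.  The parameters are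
unique (`omega_injective`: `θ` and `β` mod `2GR`), and `ω_{θ,β}` has conductor exactly `2` iff `β ∉ 2GR`
(`omega_conductor_two_iff`).  Hence `eps_eq_piVal_pow_two` for an ARBITRARY `ω : LocalChar GR44`: conjugate-dual and
non-trivial on `1 + 2GR` ⇒ `ε(½, ω, ψ̃_δ) = ω(ϖ)^n`.

Every ε-factor is Kudla's Prop. 3.8 (ii) / (3.32) on the model (`book:editornd-introduction-langlands-program`
p0109:L3–L11, L33; `PeriodCloserC7Stability.LocalChar.eps` with `κ = 1/16 = |GR(4, 4)|^{−1/2}`).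

**What this is not.**  `𝒪/𝔮^c` for `c ≥ 3` (`GR(2^c, 4)`), the identification of the octic face's characters
`χ′_j` with particular `ω_{θ,β}`, and the global (E3) are NOT here.  Nothing here says anything about the status of
the Hodge conjecture for CM abelian varieties, which is NOT proved.
-/

set_option autoImplicit false

noncomputable section

namespace Summit.Ventures.HodgeRepro.PeriodCloser

namespace GaloisRing

/-! ### `tr(δ t) = 0` for `σ`-fixed `t` -/

/-- `φ(φ(y)) = σ(y)`. -/
theorem frobLift_frobLift (y : GR44) : frobLift (frobLift y) = conjGR y := by
  rw [conjGR_eq_frobLift_comp, AlgHom.comp_apply]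

/-- **`tr(δ t) = 0` for every `σ`-fixed `t`**: `algebraMap (tr(δt)) = δt + φ(δt) + φ²(δt) + φ³(δt)` with
`φ²(δt) = σ(δ t) = σ(δ) t = −δ t` and `φ³(δt) = φ(−δt) = −φ(δt)`. -/
theorem tr_delta_mul_eq_zero_of_conjGR_fixed {t : GR44} (ht : conjGR t = t) : tr (delta * t) = 0 := by
  apply algebraMap_injective
  rw [← frobSum_eq_tr, map_zero]
  have hσ : conjGR (delta * t) = -(delta * t) := by rw [map_mul, conjGR_delta, ht, neg_mul]
  have h2 : frobLift (frobLift (delta * t)) = -(delta * t) := by rw [frobLift_frobLift, hσ]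
  have h3 : frobLift (frobLift (frobLift (delta * t))) = -(frobLift (delta * t)) := by rw [h2, map_neg]
  rw [h3, h2]
  ring

/-! ### Conjugate duality forces `5 ∣ k₀` -/

/-- **For a conjugate-dual `β` (`red2 (σ β) = red2 β`) with `r^{k₀} ≡ β` mod `2GR`: `4 k₀ = k₀` in `Fin 15`** —
`σ(β) ≡ σ(r^{k₀}) = r^{4k₀}` and `σ(β) ≡ β ≡ r^{k₀}`, and the Teichmüller residues are distinct. -/
theorem four_mul_eq_self_of_conjDual {β : GR44} (hβ : red2 (conjGR β) = red2 β) {k₀ : Fin 15}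
    (hk₀ : teich2 k₀ = red2 β) : 4 * k₀ = k₀ := by
  apply teich2_injective
  have h1 : red2 (β - r ^ (k₀ : ℕ)) = 0 := by
    rw [sub_eq_add_neg, red2_add, red2_neg, red2_r_pow, hk₀, add_neg_cancel]
  obtain ⟨b, hb⟩ := eq_two_mul_of_red2_eq_zero h1
  have h2 : conjGR β = conjGR (r ^ (k₀ : ℕ)) + 2 * conjGR b := by
    have : β = r ^ (k₀ : ℕ) + 2 * b := by linear_combination hb
    rw [this, map_add, map_mul, map_ofNat]
  calc teich2 (4 * k₀) = red2 (r ^ ((4 * k₀ : Fin 15) : ℕ)) := (red2_r_pow _).symm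
    _ = red2 (conjGR (r ^ (k₀ : ℕ))) := by rw [conjGR_r_pow]
    _ = red2 (conjGR β) := by rw [h2, red2_add, red2_two_mul, add_zero]
    _ = red2 β := hβ
    _ = teich2 k₀ := hk₀.symm

/-- `4k = k` in `Fin 15` forces `5 ∣ k` (`k ∈ {0, 5, 10}`). -/
theorem five_dvd_of_four_mul_eq {k : Fin 15} (h : 4 * k = k) : 5 ∣ (k : ℕ) := by
  revert k
  decide

/-- `σ(r^k) = r^k` when `4k = k` in `Fin 15`: the Teichmüller lifts of `𝔽₄^×` are `σ`-fixed. -/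
theorem conjGR_r_pow_eq_self {k : Fin 15} (h : 4 * k = k) : conjGR (r ^ (k : ℕ)) = r ^ (k : ℕ) := by
  rw [conjGR_r_pow, h]

/-- **`ψ̃_δ(r^k) = 1` for `4k = k`**: `tr(δ r^k) = 0` since `r^k` is `σ`-fixed. -/
theorem psiTildeGR_r_pow_eq_one {k : Fin 15} (h : 4 * k = k) : psiTildeGR (r ^ (k : ℕ)) = 1 := by
  rw [psiTildeGR_apply, tr_delta_mul_eq_zero_of_conjGR_fixed (conjGR_r_pow_eq_self h)]
  exact AddChar.map_zero_eq_one psi4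

/-- `θ⁻¹^k = 1` for `θ⁵ = 1` and `5 ∣ k`. -/
theorem inv_pow_eq_one_of_five {θ : ℂ} (hθ5 : θ ^ 5 = 1) {k : ℕ} (hk : 5 ∣ k) : θ⁻¹ ^ k = 1 := by
  obtain ⟨m, rfl⟩ := hk
  rw [inv_pow, pow_mul, hθ5, one_pow, inv_one]

/-! ### The root number of a conjugate-dual character of conductor `2` is `ω(ϖ)^n` -/

/-- **The conductor-`2` root number at `𝔮` of a conjugate-dual `ω_{θ,β}` is exactly `ω(ϖ)^n`**: with `θ⁵ = 1`,
`σ(β) ≡ β` mod `2GR` and `r^{k₀} ≡ β`, `ε(½, ⟨ω_{θ,β}, π⟩, ψ̃_δ) = π^n` — in `eps_omega`'s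
`π^n θ^{−k₀} ψ̃_δ(r^{k₀})` both unit-part factors are `1`. -/
theorem eps_omega_conjDual_exact (θ : ℂ) (hθ : θ ^ 15 = 1) (hθ5 : θ ^ 5 = 1) (β : GR44)
    (hβ : red2 (conjGR β) = red2 β) (k₀ : Fin 15) (hk₀ : teich2 k₀ = red2 β) (n : ℕ) (π : ℂ) :
    LocalChar.eps (1 / 16) n (⟨omega θ hθ β, π⟩ : LocalChar GR44) psiTildeGR = π ^ n := by
  have h4 := four_mul_eq_self_of_conjDual hβ hk₀
  rw [eps_omega θ hθ β k₀ hk₀, psiTildeGR_r_pow_eq_one h4,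
    inv_pow_eq_one_of_five hθ5 (five_dvd_of_four_mul_eq h4)]
  ring

/-- The same from conjugate duality as a property of the character (`ω ∘ σ = ω⁻¹`) and conductor exactly `2`
(`β ∉ 2GR`). -/
theorem eps_conjDual_exact (θ : ℂ) (hθ : θ ^ 15 = 1) (β : GR44) (hβ2 : red2 β ≠ 0)
    (hσ : ∀ x, omega θ hθ β (conjGR x) = (omega θ hθ β)⁻¹ x) (n : ℕ) (π : ℂ) :
    LocalChar.eps (1 / 16) n (⟨omega θ hθ β, π⟩ : LocalChar GR44) psiTildeGR = π ^ n := by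
  obtain ⟨hθ5, hβ⟩ := (omega_conjDual_iff θ hθ β).1 hσ
  obtain ⟨k₀, hk₀⟩ := teich2_surj (red2 β) hβ2
  exact eps_omega_conjDual_exact θ hθ hθ5 β hβ k₀ hk₀ n π

/-- **(E3) at `𝔮 | 2`, conductor `2`, ACROSS the wild classes**: for four conjugate-dual lines
`⟨ω_{θ_j,β_j}, π_j⟩` of conductor exactly `2` — any `β_j`, no hypothesis on the unit parts beyond conjugate duality —
`ε₀ε₁ = ε₂ε₃` is exactly the `ϖ`-part `π₀π₁ = π₂π₃` of N2 (`ε_j = π_j^n`). -/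
theorem E3_conjDual_inert_two (θ : Fin 4 → ℂ) (hθ : ∀ j, θ j ^ 15 = 1) (β : Fin 4 → GR44)
    (hβ2 : ∀ j, red2 (β j) ≠ 0)
    (hσ : ∀ j x, omega (θ j) (hθ j) (β j) (conjGR x) = (omega (θ j) (hθ j) (β j))⁻¹ x)
    (π : Fin 4 → ℂ) (hπ : π 0 * π 1 = π 2 * π 3) (n : ℕ) :
    LocalChar.eps (1 / 16) n (⟨omega (θ 0) (hθ 0) (β 0), π 0⟩ : LocalChar GR44) psiTildeGR *
        LocalChar.eps (1 / 16) n (⟨omega (θ 1) (hθ 1) (β 1), π 1⟩ : LocalChar GR44) psiTildeGR =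
      LocalChar.eps (1 / 16) n (⟨omega (θ 2) (hθ 2) (β 2), π 2⟩ : LocalChar GR44) psiTildeGR *
        LocalChar.eps (1 / 16) n (⟨omega (θ 3) (hθ 3) (β 3), π 3⟩ : LocalChar GR44) psiTildeGR := by
  rw [eps_conjDual_exact _ _ _ (hβ2 0) (hσ 0), eps_conjDual_exact _ _ _ (hβ2 1) (hσ 1),
    eps_conjDual_exact _ _ _ (hβ2 2) (hσ 2), eps_conjDual_exact _ _ _ (hβ2 3) (hσ 3), ← mul_pow, hπ, mul_pow]

/-- **Conjugate-symplectic characters of conductor `2` at `𝔮` exactly** (`ω(ϖ) = −1` on the model):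
`ε(½, ω, ψ̃_δ) = (−1)^n`. -/
theorem eps_conjSymplectic_inert_two (θ : ℂ) (hθ : θ ^ 15 = 1) (β : GR44) (hβ2 : red2 β ≠ 0)
    (hσ : ∀ x, omega θ hθ β (conjGR x) = (omega θ hθ β)⁻¹ x) (n : ℕ) :
    LocalChar.eps (1 / 16) n (⟨omega θ hθ β, -1⟩ : LocalChar GR44) psiTildeGR = (-1) ^ n :=
  eps_conjDual_exact θ hθ β hβ2 hσ n (-1)

/-- **Conjugate-orthogonal characters of conductor `2` at `𝔮` exactly** (`ω(ϖ) = 1`): `ε(½, ω, ψ̃_δ) = 1`. -/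
theorem eps_conjOrthogonal_inert_two (θ : ℂ) (hθ : θ ^ 15 = 1) (β : GR44) (hβ2 : red2 β ≠ 0)
    (hσ : ∀ x, omega θ hθ β (conjGR x) = (omega θ hθ β)⁻¹ x) (n : ℕ) :
    LocalChar.eps (1 / 16) n (⟨omega θ hθ β, 1⟩ : LocalChar GR44) psiTildeGR = 1 := by
  rw [eps_conjDual_exact θ hθ β hβ2 hσ n 1, one_pow]

/-! ### The parameters multiply (the transport of N2), and the stability form of (E3) -/

/-- **`ω_{θ,β} ω_{θ′,β′} = ω_{θθ′,β+β′}`** — the transport of N2 (`χ′₀χ′₁ = χ′₂χ′₃`) to the parameters. -/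
theorem omega_mul (θ θ' : ℂ) (hθ : θ ^ 15 = 1) (hθ' : θ' ^ 15 = 1) (β β' : GR44) :
    omega θ hθ β * omega θ' hθ' β' = omega (θ * θ') (by rw [mul_pow, hθ, hθ', one_mul]) (β + β') := by
  apply MulChar.ext
  intro u
  obtain ⟨k, a, hu⟩ := exists_teichmuller_mul_of_isUnit u.isUnit
  rw [MulChar.coeToFun_mul, Pi.mul_apply, hu, omega_apply, omega_apply, omega_apply, mul_pow,
    show 2 * (β + β') * a = 2 * β * a + 2 * β' * a by ring, AddChar.map_add_eq_mul]
  ring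

/-- **(E3) at `𝔮`, conductor `2`, in the stability form**: four tame lines `⟨ω_{θ_j,0}, π_j⟩` twisted by ONE
character `ρ = ⟨ω_{θ_ρ,β}, π_ρ⟩` of conductor exactly `2` (`β ∉ 2GR`) satisfy `ε(χ₀ρ) ε(χ₁ρ) = ε(χ₂ρ) ε(χ₃ρ)` under
N2 on the parameters (`θ₀θ₁ = θ₂θ₃`, `π₀π₁ = π₂π₃`) — the inert, conductor-`2` analogue of
`OcticCMPointDualSign.eps_tame_twist_two`: all four products lie in the wild class of `β`. -/
theorem E3_tame_twist_inert_two (θ : Fin 4 → ℂ) (hθ : ∀ j, θ j ^ 15 = 1) (hθN2 : θ 0 * θ 1 = θ 2 * θ 3)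
    (π : Fin 4 → ℂ) (hπ : π 0 * π 1 = π 2 * π 3) (θρ : ℂ) (hθρ : θρ ^ 15 = 1) (β : GR44) (hβ : red2 β ≠ 0)
    (πρ : ℂ) (n : ℕ) :
    LocalChar.eps (1 / 16) n
          ((⟨omega (θ 0) (hθ 0) 0, π 0⟩ : LocalChar GR44) * ⟨omega θρ hθρ β, πρ⟩) psiTildeGR *
        LocalChar.eps (1 / 16) n
          ((⟨omega (θ 1) (hθ 1) 0, π 1⟩ : LocalChar GR44) * ⟨omega θρ hθρ β, πρ⟩) psiTildeGR =
      LocalChar.eps (1 / 16) n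
          ((⟨omega (θ 2) (hθ 2) 0, π 2⟩ : LocalChar GR44) * ⟨omega θρ hθρ β, πρ⟩) psiTildeGR *
        LocalChar.eps (1 / 16) n
          ((⟨omega (θ 3) (hθ 3) 0, π 3⟩ : LocalChar GR44) * ⟨omega θρ hθρ β, πρ⟩) psiTildeGR := by
  -- the products, as pairs: `⟨ω_{θ_j θ_ρ, β}, π_j π_ρ⟩`
  have hprod : ∀ j, ((⟨omega (θ j) (hθ j) 0, π j⟩ : LocalChar GR44) * ⟨omega θρ hθρ β, πρ⟩) =
      ⟨omega (θ j * θρ) (by rw [mul_pow, hθ j, hθρ, one_mul]) β, π j * πρ⟩ := by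
    intro j
    show (⟨omega (θ j) (hθ j) 0 * omega θρ hθρ β, π j * πρ⟩ : LocalChar GR44) = _
    rw [omega_mul, zero_add]
  simp only [hprod]
  obtain ⟨k₀, hk₀⟩ := teich2_surj (red2 β) hβ
  exact E3_omega_of_N2 (fun j => θ j * θρ) (fun j => by rw [mul_pow, hθ j, hθρ, one_mul]) (fun _ => β) k₀
    (fun _ => hk₀) (by rw [mul_mul_mul_comm, hθN2, mul_mul_mul_comm]) (fun j => π j * πρ)
    (by rw [mul_mul_mul_comm, hπ, mul_mul_mul_comm]) n

/-! ### Completeness: every character of `GR(4, 4)^×` is an `ω_{θ,β}` -/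

/-- `χ(r)` is a `15`-th root of unity. -/
theorem mulChar_r_pow_fifteen (χ : MulChar GR44 ℂ) : χ r ^ 15 = 1 := by
  rw [← map_pow, r_pow_fifteen, map_one]

/-- **The wild part of a character**: `a ↦ χ(1 + 2a)`, an additive character of `GR(4, 4)`
(`(1 + 2a)(1 + 2b) = 1 + 2(a + b)` since `4 = 0`). -/
def wildOf (χ : MulChar GR44 ℂ) : AddChar GR44 ℂ where
  toFun a := χ (1 + 2 * a)
  map_zero_eq_one' := by
    show χ (1 + 2 * 0) = 1
    rw [mul_zero, add_zero, map_one]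
  map_add_eq_mul' := by
    intro a b
    show χ (1 + 2 * (a + b)) = χ (1 + 2 * a) * χ (1 + 2 * b)
    rw [← map_mul]
    congr 1
    have h4 := four_eq_zero
    linear_combination (-(a * b)) * h4

/-- `wildOf χ a = χ(1 + 2a)`. -/
theorem wildOf_apply (χ : MulChar GR44 ℂ) (a : GR44) : wildOf χ a = χ (1 + 2 * a) := rfl

/-- The wild part is trivial on `2GR`: `χ(1 + 4b) = 1`. -/
theorem wildOf_two_mul (χ : MulChar GR44 ℂ) (b : GR44) : wildOf χ (2 * b) = 1 := by
  rw [wildOf_apply]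
  have h4 := four_eq_zero
  rw [show (1 : GR44) + 2 * (2 * b) = 1 by linear_combination b * h4, map_one]

/-- **Every additive character of `GR(4, 4)` is `ψ̃_δ(γ ·)`**: `γ ↦ ψ̃_δ(γ ·)` is injective (primitivity) between
finite sets of the same size (`AddChar.card_eq`). -/
theorem exists_mulShift_psiTildeGR (χ : AddChar GR44 ℂ) : ∃ γ : GR44, χ = AddChar.mulShift psiTildeGR γ := by
  have hbij : Function.Bijective (fun γ : GR44 => AddChar.mulShift psiTildeGR γ) :=
    (Fintype.bijective_iff_injective_and_card _).2
      ⟨fun a b h => mulShift_psiTildeGR_injective h, AddChar.card_eq.symm⟩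
  obtain ⟨γ, hγ⟩ := hbij.2 χ
  exact ⟨γ, hγ.symm⟩

/-- **Every character of `GR(4, 4)^×` is an `ω_{θ,β}`**: `θ = χ(r)`, and the wild part `χ(1 + 2 ·)` is
`ψ̃_δ(γ ·)` with `γ ∈ 2GR` (it is trivial on `2GR`, and `ψ̃_δ` is primitive), i.e. `ψ̃_δ(2β ·)`. -/
theorem exists_omega_eq (χ : MulChar GR44 ℂ) : ∃ (θ : ℂ) (hθ : θ ^ 15 = 1) (β : GR44), χ = omega θ hθ β := by
  obtain ⟨γ, hγ⟩ := exists_mulShift_psiTildeGR (wildOf χ)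
  have h2γ : 2 * γ = 0 := by
    by_contra h
    apply psiTildeGR_isPrimitive h
    ext b
    have := DFunLike.congr_fun hγ (2 * b)
    rw [wildOf_two_mul, AddChar.mulShift_apply] at this
    rw [AddChar.mulShift_apply, AddChar.one_apply, show 2 * γ * b = γ * (2 * b) by ring]
    exact this.symm
  obtain ⟨β, hβ⟩ := eq_two_mul_of_red2_eq_zero (red2_eq_zero_of_two_mul_eq_zero h2γ)
  refine ⟨χ r, mulChar_r_pow_fifteen χ, β, ?_⟩
  apply MulChar.ext
  intro u
  obtain ⟨k, a, hu⟩ := exists_teichmuller_mul_of_isUnit u.isUnit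
  rw [hu, omega_apply, map_mul, map_pow]
  congr 1
  have := DFunLike.congr_fun hγ a
  rw [wildOf_apply, AddChar.mulShift_apply, hβ] at this
  exact this

/-- **The parameters are unique**: `ω_{θ,β} = ω_{θ′,β′}` forces `θ = θ′` (evaluate at `r`) and `β ≡ β′` mod `2GR`
(evaluate on `1 + 2GR`, then the primitivity of `ψ̃_δ`). -/
theorem omega_injective {θ θ' : ℂ} {hθ : θ ^ 15 = 1} {hθ' : θ' ^ 15 = 1} {β β' : GR44}
    (h : omega θ hθ β = omega θ' hθ' β') : θ = θ' ∧ red2 β = red2 β' := by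
  constructor
  · have := DFunLike.congr_fun h (r ^ ((1 : Fin 15) : ℕ))
    rw [omega_teichmuller, omega_teichmuller, Fin.val_one, pow_one, pow_one] at this
    exact this
  · have hw : ∀ a, psiTildeGR (2 * β * a) = psiTildeGR (2 * β' * a) := by
      intro a
      have := congrArg (fun χ : MulChar GR44 ℂ => χ (1 + 2 * a)) h
      simpa only [omega_one_add] using this
    have key : AddChar.mulShift psiTildeGR (2 * β) = AddChar.mulShift psiTildeGR (2 * β') := by
      ext a
      rw [AddChar.mulShift_apply, AddChar.mulShift_apply, hw]
    have h2 : 2 * (β - β') = 0 := by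
      have := mulShift_psiTildeGR_injective key
      linear_combination this
    have h3 := red2_eq_zero_of_two_mul_eq_zero h2
    rw [sub_eq_add_neg, red2_add, red2_neg] at h3
    exact sub_eq_zero.1 (by rw [sub_eq_add_neg]; exact h3)

/-- **Conductor exactly `2` iff `β ∉ 2GR`**: `ω_{θ,β}` is non-trivial on `1 + 2GR` iff `red2 β ≠ 0`. -/
theorem omega_conductor_two_iff (θ : ℂ) (hθ : θ ^ 15 = 1) (β : GR44) :
    (∃ a, omega θ hθ β (1 + 2 * a) ≠ 1) ↔ red2 β ≠ 0 := by
  constructor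
  · rintro ⟨a, ha⟩ h0
    apply ha
    rw [omega_one_add, show 2 * β * a = (2 * β) * a by ring, two_mul_eq_zero_of_red2_eq_zero h0, zero_mul,
      AddChar.map_zero_eq_one]
  · exact omega_wild_nontrivial θ hθ β

/-- **The conductor-`2` root number at `𝔮 | 2` of EVERY conjugate-dual character is `ω(ϖ)^n`**: for an
arbitrary `ω : LocalChar GR44` whose unit part is non-trivial on `1 + 2GR` (conductor exactly `2`) and
conjugate-dual (`ω ∘ σ = ω⁻¹` on the units), `ε(½, ω, ψ̃_δ) = ω(ϖ)^n` — the conductor-`2` twin of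
`OcticCMPointInertGauss.eps_eq_piVal_pow`. -/
theorem eps_eq_piVal_pow_two (ω : LocalChar GR44) (hc : ∃ a, ω.unit (1 + 2 * a) ≠ 1)
    (hσ : ∀ x, ω.unit (conjGR x) = ω.unit⁻¹ x) (n : ℕ) :
    LocalChar.eps (1 / 16) n ω psiTildeGR = ω.piVal ^ n := by
  obtain ⟨θ, hθ, β, hω⟩ := exists_omega_eq ω.unit
  have hβ2 : red2 β ≠ 0 := (omega_conductor_two_iff θ hθ β).1 (by rw [← hω]; exact hc)
  have key := eps_conjDual_exact θ hθ β hβ2 (fun x => by rw [← hω]; exact hσ x) n ω.piVal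
  rw [← hω] at key
  exact key

/-- **(E3) at `𝔮 | 2`, conductor `2`, for arbitrary conjugate-dual characters**: four `ω_j : LocalChar GR44`,
each non-trivial on `1 + 2GR` and conjugate-dual, satisfy `ε₀ε₁ = ε₂ε₃` exactly when... always, given the `ϖ`-part
`π₀π₁ = π₂π₃` of N2 — no hypothesis on the unit parts beyond conjugate duality. -/
theorem E3_inert_two_exact (ω : Fin 4 → LocalChar GR44) (hc : ∀ j, ∃ a, (ω j).unit (1 + 2 * a) ≠ 1)
    (hσ : ∀ j x, (ω j).unit (conjGR x) = (ω j).unit⁻¹ x)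
    (hN2 : (ω 0).piVal * (ω 1).piVal = (ω 2).piVal * (ω 3).piVal) (n : ℕ) :
    LocalChar.eps (1 / 16) n (ω 0) psiTildeGR * LocalChar.eps (1 / 16) n (ω 1) psiTildeGR =
      LocalChar.eps (1 / 16) n (ω 2) psiTildeGR * LocalChar.eps (1 / 16) n (ω 3) psiTildeGR := by
  rw [eps_eq_piVal_pow_two (ω 0) (hc 0) (hσ 0), eps_eq_piVal_pow_two (ω 1) (hc 1) (hσ 1),
    eps_eq_piVal_pow_two (ω 2) (hc 2) (hσ 2), eps_eq_piVal_pow_two (ω 3) (hc 3) (hσ 3), ← mul_pow, hN2, mul_pow]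

end GaloisRing

end Summit.Ventures.HodgeRepro.PeriodCloser

end
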